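import Mathlib
import Literature.NumberTheory.LFunctions.WeilFirstPrimeCertificateZ
import Literature.NumberTheory.LFunctions.WeilFirstPrimeCertificateDataC
import HarnessLib

/-!
# Transfer of the kernel-checked Stage-C moment table to another half-length `a₀`

Stub `stub_checkNuTransfer` (NUT) of line *parity–multiplicity–commutator* (v5) of the crux
`GroundStateSimpleEven` (Weil ground state).  The odd-margin certificates of the lead reuse the level
`wL`, the cut-off `T` and the 145 cells of the Stage-C first-prime certificate `weilCert3C`
(`WeilFirstPrimeCertificateDataC.lean`) at other half-lengths `a₀ ∈ {2/5, 23/50, 51/100}`.  The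
moment check `WeilCert3.checkNuAt q` compares the claimed (scaled) moment `ν̃_q` with
`nuScale · a₀^q · 2 · cellsMomentQ₂ wL cells q`; the cell moments do not depend on `a₀`, so the
expensive kernel evaluation done once for `weilCert3C` (`checkNuAt{q}_weilCert3C`, tolerance `2⁻⁶⁴`)
transfers to any certificate with the same `wL` and cells by rescaling with `r^q`,
`r = a₀ · 1024/563`, at the price of a test on literals:
`|ν̃'_q − r^q ν̃_q| + r^q 2⁻⁶⁴ ≤ 2^{-pnu}`.
-/

open Literature.NumberTheory.LFunctions

namespace Summit.RiemannHypothesis.RiemannHypothesis.Theorems.GroundStateSimpleEven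

set_option linter.dupNamespace false in
/-- The moments of two `WeilCert3` certificates with the same level and cells differ by the factor
`(a₀'/a₀)^q`. [folklore] -/
theorem nut_nuQ_eq_mul (c : WeilCert3) (q : ℕ) (hcells : c.cells = weilCert3C.cells)
    (hwL : c.base.wL = weilCert3C.base.wL) :
    c.nuQ q = (c.base.a0 / (563 / 1024)) ^ q * weilCert3C.nuQ q := by
  unfold WeilCert3.nuQ
  rw [hcells, hwL]
  have ha : weilCert3C.base.a0 = 563 / 1024 := rfl
  rw [ha]
  have hne : ((563 : ℚ) / 1024) ^ q ≠ 0 := pow_ne_zero q (by norm_num)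
  field_simp
  rw [mul_assoc, ← mul_pow, show c.base.a0 * 1024 / 563 * (563 / 1024) = c.base.a0 by ring]
  ring

set_option linter.dupNamespace false in
/-- The Stage-C tolerance is `2⁻⁶⁴`. [folklore] -/
theorem nut_pnu_weilCert3C : weilCert3C.pnu = 64 := rfl

end Summit.RiemannHypothesis.RiemannHypothesis.Theorems.GroundStateSimpleEven

namespace Summit.RiemannHypothesis.RiemannHypothesis.Theorems

set_option linter.dupNamespace false in
open GroundStateSimpleEven in
/-- **Registered sub-goal (NUT) of line `parity-multiplicity-commutator` (v5): transfer of the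
kernel-checked moment table of `weilCert3C` to another `a₀`.** If `c` reuses the level and the cells
of `weilCert3C`, entry `q` of the Stage-C table is within `2⁻⁶⁴` of `nuScale · ν_q(563/1024)`
(`weilCert3C.checkNuAt q`), and the claimed entry of `c` passes the literal test
`|ν̃'_q − r^q ν̃_q| + r^q 2⁻⁶⁴ ≤ 2^{-pnu(c)}` with `r = a₀(c)·1024/563 ≥ 0`, then `c.checkNuAt q`
holds (triangle inequality; `ν_q(a₀) = r^q ν_q(563/1024)`). [folklore] -/
theorem stub_checkNuTransfer :
    ∀ (c : WeilCert3) (q : ℕ), c.cells = weilCert3C.cells → c.base.wL = weilCert3C.base.wL →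
      weilCert3C.checkNuAt q = true →
      |getV c.nuData q - (c.base.a0 / (563 / 1024)) ^ q * getV weilCert3CNuData q| +
          (c.base.a0 / (563 / 1024)) ^ q * (1 / 2 ^ 64) ≤ 1 / 2 ^ c.pnu →
      0 ≤ c.base.a0 →
      c.checkNuAt q = true := by
  intro c q hcells hwL hC hlit ha0
  unfold WeilCert3.checkNuAt at hC ⊢
  rw [decide_eq_true_eq] at hC ⊢
  rw [nut_pnu_weilCert3C] at hC
  have hdata : weilCert3C.nuData = weilCert3CNuData := rfl
  rw [hdata] at hC
  set r : ℚ := c.base.a0 / (563 / 1024) with hr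
  have hr0 : 0 ≤ r ^ q := pow_nonneg (div_nonneg ha0 (by norm_num)) q
  rw [nut_nuQ_eq_mul c q hcells hwL, ← hr]
  set ν := getV weilCert3CNuData q
  set ν' := getV c.nuData q
  set m := weilCert3C.nuQ q
  have h1 : |r ^ q * ν - nuScale * (r ^ q * m)| ≤ r ^ q * (1 / 2 ^ 64) := by
    rw [show r ^ q * ν - nuScale * (r ^ q * m) = r ^ q * (ν - nuScale * m) by ring, abs_mul,
      abs_of_nonneg hr0]
    exact mul_le_mul_of_nonneg_left hC hr0
  calc |ν' - nuScale * (r ^ q * m)|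
      = |(ν' - r ^ q * ν) + (r ^ q * ν - nuScale * (r ^ q * m))| := by ring_nf
    _ ≤ |ν' - r ^ q * ν| + |r ^ q * ν - nuScale * (r ^ q * m)| := abs_add_le _ _
    _ ≤ |ν' - r ^ q * ν| + r ^ q * (1 / 2 ^ 64) := by linarith
    _ ≤ 1 / 2 ^ c.pnu := hlit

end Summit.RiemannHypothesis.RiemannHypothesis.Theorems
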